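import Summits.QuantumFields.BalabanUV.Beta.AdjointCarrierWiringEnd

/-!
# T⁴ programme, spine node NE2 (U1a) — R14 W3c, file 10: THE ADJOINT FRAME's CARRIER IS A LIE SUBALGEBRA — Ad-STABILITY ⟹ CLOSURE UNDER `X ↦ i[Y, X]`
# (cell `pub-balaban-gaps`, seat ne2 gen 6; companion of `OneStepRemainderAdjoint` / `ComposedRemainderGaugeTower`)

The β cell packages the adjoint frame as `AdjointCarrierWiringEnd.CompFamily c P e` (positivity, hermiticity, membership, orthonormality, completeness, and STABILITY of the real subspace `P`
under `R(u) = Ad u` for every unitary `u`), while gen 5's `OneStepRemainderAdjoint.norm_coeffG₁/₂/₃_le` and this gen's files 3/4/6 need the LIE CLOSURE `hPad : Y, X ∈ P ⟹ i(YX − XY) ∈ P`.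
THIS FILE derives the latter from the former: for `Y ∈ P` (hermitian) the path `t ↦ e^{itY} X e^{−itY} = R(e^{itY})X` stays in `P` (`exp_mem_unitary_of_mem_skewAdjoint`, `Matrix.exp_neg`), its
derivative at `t = 0` is `i[Y, X]` (`hasDerivAt_exp_smul_const`), and a finite-dimensional subspace is closed (`Submodule.closed_of_finiteDimensional`), so the limit of the slopes lies in `P`:
**`lie_mem_of_stable`**, and **`CompFamily.lie_mem`** for the packaged frame.
HONEST FRAMING (T4-DAG p. 1).  [folklore] linear algebra / one-variable calculus; nothing of Bałaban's asserted; NOT NE2; **NE2 (U1a) NOT PROVED**; spine PROVED 0/9 unchanged; NOT continuum YM /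
infinite volume / mass gap / Clay.  No `sorry`.
-/

noncomputable section

open scoped Matrix Matrix.Norms.L2Operator Topology

namespace Summit.QuantumFields.BalabanUV.T4Continuum.NE2.AdjointFrameLieClosure

open Literature.MathematicalPhysics.QuantumFieldTheory.Balaban1983to89.B9AdOrthogonal (R)
open Summit.QuantumFields.BalabanUV.Beta.AdjointCarrierWiringEnd (CompFamily)

variable {n : Type} [Fintype n] [DecidableEq n]

/-- **THE FRAME's CARRIER IS A LIE SUBALGEBRA**: a real subspace `P` of hermitian matrices that is stable under `Ad` of every unitary is closed under `X ↦ i[Y, X]` for `Y ∈ P` — differentiate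
the path `t ↦ e^{itY} X e^{−itY} ∈ P` at `t = 0` (`hasDerivAt_exp_smul_const`) and use that a finite-dimensional subspace is closed.  This discharges the hypothesis `hPad` of
`OneStepRemainderAdjoint.norm_coeffG₁/₂/₃_le` for every `CompFamily`. [folklore] -/
theorem lie_mem_of_stable (P : Submodule ℝ (Matrix n n ℂ)) (hPh : ∀ X ∈ P, X.IsHermitian) (hst : ∀ u ∈ Matrix.unitaryGroup n ℂ, ∀ X ∈ P, R u X ∈ P) {Y X : Matrix n n ℂ}
    (hY : Y ∈ P) (hX : X ∈ P) : Complex.I • (Y * X - X * Y) ∈ P := by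
  letI : NormedAlgebra ℚ (Matrix n n ℂ) := NormedAlgebra.restrictScalars ℚ ℂ _
  set A : Matrix n n ℂ := Complex.I • Y with hA
  have hAskew : star A = -A := by
    rw [hA, star_smul, Matrix.star_eq_conjTranspose, (hPh Y hY).eq, Complex.star_def, Complex.conj_I, neg_smul]
  have hmem : ∀ t : ℝ, NormedSpace.exp (t • A) ∈ Matrix.unitaryGroup n ℂ := fun t =>
    NormedSpace.exp_mem_unitary_of_mem_skewAdjoint (by rw [skewAdjoint.mem_iff, star_smul, hAskew, smul_neg, star_trivial])
  set g : ℝ → Matrix n n ℂ := fun t => NormedSpace.exp (t • A) * X * NormedSpace.exp (t • (-A)) with hg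
  have hgP : ∀ t, g t ∈ P := by
    intro t
    have h := hst _ (hmem t) X hX
    rw [Literature.MathematicalPhysics.QuantumFieldTheory.Balaban1983to89.B9AdOrthogonal.R_apply] at h
    have hinv : (NormedSpace.exp (t • A))⁻¹ = NormedSpace.exp (t • (-A)) := by rw [smul_neg, Matrix.exp_neg]
    rwa [hinv] at h
  have hg0 : g 0 = X := by simp [hg]
  have hd1 : HasDerivAt (fun t : ℝ => NormedSpace.exp (t • A)) A 0 := by
    have h := hasDerivAt_exp_smul_const (𝕂 := ℝ) A (0 : ℝ)
    rwa [zero_smul, NormedSpace.exp_zero, one_mul] at h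
  have hd2 : HasDerivAt (fun t : ℝ => NormedSpace.exp (t • (-A))) (-A) 0 := by
    have h := hasDerivAt_exp_smul_const (𝕂 := ℝ) (-A) (0 : ℝ)
    rwa [zero_smul, NormedSpace.exp_zero, one_mul] at h
  have hd : HasDerivAt g (A * X - X * A) 0 := by
    have h := (hd1.mul_const X).mul hd2
    have e : A * X * NormedSpace.exp ((0 : ℝ) • (-A)) + NormedSpace.exp ((0 : ℝ) • A) * X * -A = A * X - X * A := by
      rw [zero_smul, zero_smul, NormedSpace.exp_zero, mul_one, one_mul, mul_neg, sub_eq_add_neg]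
    rw [e] at h
    exact h
  have hslope : ∀ t : ℝ, slope g 0 t ∈ P := fun t => by
    rw [slope_def_module, hg0]
    exact P.smul_mem _ (P.sub_mem (hgP t) hX)
  have hclosed : IsClosed (P : Set (Matrix n n ℂ)) := P.closed_of_finiteDimensional
  have hlim : A * X - X * A ∈ P :=
    hclosed.mem_of_tendsto (hasDerivAt_iff_tendsto_slope.mp hd) (eventually_nhdsWithin_of_forall fun t _ => hslope t)
  have e : Complex.I • (Y * X - X * Y) = A * X - X * A := by rw [hA, Matrix.smul_mul, Matrix.mul_smul, smul_sub]
  rw [e]; exact hlim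

/-- the packaged frame of the β cell is Lie-closed. [folklore] -/
theorem CompFamily.lie_mem {ι : Type} [Fintype ι] [DecidableEq ι] {c : ℝ} {P : Submodule ℝ (Matrix n n ℂ)} {e : ι → Matrix n n ℂ} (hF : CompFamily c P e) {Y X : Matrix n n ℂ} (hY : Y ∈ P) (hX : X ∈ P) :
    Complex.I • (Y * X - X * Y) ∈ P :=
  lie_mem_of_stable P hF.herm hF.stable hY hX

end Summit.QuantumFields.BalabanUV.T4Continuum.NE2.AdjointFrameLieClosure

end
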